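import Summits.CriticalPhenomena.Ising3DConformalLimit.Theorems.EnergyNotSigmaSquaredGapForcesFarMergingScreeningReduction
import Summits.CriticalPhenomena.Ising3DConformalLimit.Theorems.EnergyNotSigmaSquaredGapForcesFarMergingScreeningUnpinGlue

/-!
# Line `backbone-transparency-dichotomy` IS line `screening-form-lemma-a1` — kernel-checked dictionary
# (crux `GapForcesFarMerging`, item stmt-CriticalPhenomena-4468; lead seat c3, 2026-08-16)

The checked skeleton `Cruxes/GapForcesFarMerging/Lines/backbone-transparency-dichotomy.lean` (planner
`planner-cruxplan-stmt-CriticalPhenomena-4468-backbone-transparenc-0`) posits the objects `boxTwoPoint`,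
`transparency`, `innerCluster`, `clusterTransparency`, `meanTransparency`, `DoublingWindow`, `FarOpacityIO`
(copied VERBATIM below, same namespace as the skeleton) and four stubs S1–S4. This file certifies, by `rfl`
/ `Iff.rfl` against the LANDED objects of the screening line
(`Theorems/EnergyNotSigmaSquaredGapForcesFarMergingScreeningDefs.lean`, p85250, namespace
`…GapForcesFarMergingScreening`), that

* `boxTwoPoint = Screening.boxTwoPoint`, `transparency = screening`, `innerCluster = Screening.innerCluster`,
  `clusterTransparency = screenWeight`, `meanTransparency = meanScreening` (definitional, `rfl`);
* `DoublingWindow = Screening.DoublingWindow` and `FarOpacityIO ↔ FarScreeningIO` (`Iff.rfl`);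
* hence S4 `stub_farMerging : FarOpacityIO → FarMergingShape cc2 (criticalCorr 3 4)` IS the landed screening
  S7 (`stub_farMerging`, p85926) fed with the landed dictionary S0 (`stub_screeningIdentity`, p87176):
  `stub_farMerging_of_screening` below, sorry-free;
* the backbone one-pinch ladder `onePinch n r t = meanScreening n r 0 (t,0,t) e₂ (t,0,-t)` is the screening ladder
  `pinchScreen n r m = meanScreening n r 0 (2m,m,0) e₂ (2m,-m,0)` at a ROTATED pinch geometry (far ends spread
  along `e₃` instead of `e₂`; no lattice symmetry fixing the bond `{0,e₂}` maps one to the other, so S1–S3 are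
  the screening statements S0+S2 / Floors+S4 / S6 re-instantiated, not literally equal): S1
  (`EnergyGapPowerLaw → OnePinchTransparencyDecay`) is proved word for word as the landed
  `stub_screeningDecay ∘ singlePinchLawShape_of_gap` with `(up m, dn m) ↦ (pSrc t, qPrb t)`; S2
  (`OnePinchTransparencyDecay → OpaqueScalesIO`) = the open `Floors` (≡ `SeparationUnderTilt`, certified by
  `separation_of_floors` / `floors_of_separation`) + the landed counting `stub_rootOpacity` (p95933), octave index
  shifted by one (`OpaqueScalesIO` reads the drop `2^{k-1} → 2^k` with `t ≥ 2^{k+2}`, `RootOpacityIO` the drop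
  `2^k → 2^{k+1}` with `m ≥ 2^{k+3}`); S3 (`OpaqueScalesIO → FarOpacityIO`, hardest) = the open
  `stub_farScreening`, reshaped by seat c2 into `HazardRelocation ∧ Unpin` (…ScreeningDefsUnpin, p121468;
  glue p121744) — the crux's common core.

Consequence for the planners: the backbone slug carries no statement, object or lever that the screening line
does not already have in the tree; its residual is `Floors ∧ HazardRelocation ∧ Unpin` (registered skeleton of
seat c2, certificate `gapForcesFarMerging_of_floors_hazardRelocation_unpin`, p121744), and driving it would
re-land p86247 / p95933 / p85926 / p100284 at a rotated geometry. Verdict of the lead: ONE line, two slugs.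
-/

noncomputable section

namespace Summit.CriticalPhenomena.Ising3DConformalLimit.Cruxes.GapForcesFarMerging.BackboneTransparencyDichotomy

open scoped symmDiff
open MeasureTheory Filter
open Literature.Probability.LatticeModels Literature.Probability.Percolation
open Summit.CriticalPhenomena.Ising3DConformalLimit.Theses.EnergyNotSigmaSquared
open Summit.CriticalPhenomena.Ising3DConformalLimit.Theorems.GapForcesFarMerging.Negative (cc2 FarMergingShape)
open Summit.CriticalPhenomena.Ising3DConformalLimit.GapForcesFarMergingScreening
  (screening screenWeight meanScreening pinchScreen FarScreeningIO ScreeningIdentity Floors HazardRelocation Unpin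
    gapForcesFarMerging_of_floors_hazardRelocation_unpin)
open Summit.CriticalPhenomena.Ising3DConformalLimit.EnergyNotSigmaSquaredGapForcesFarMerging
  (stub_farMerging stub_screeningIdentity)

/-! ## The backbone skeleton's vocabulary, copied verbatim -/

/-- `e₁ = (1,0,0)`. [folklore] -/
abbrev e₁ : Site 3 := Pi.single 0 1
/-- `e₂ = (0,1,0)`. [folklore] -/
abbrev e₂ : Site 3 := Pi.single 1 1
/-- `e₃ = (0,0,1)`. [folklore] -/
abbrev e₃ : Site 3 := Pi.single 2 1

/-- (backbone) depleted box two-point function. [cite: AizenmanDuminilCopinAnnals2021, App. A, Lemma A.1] -/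
def boxTwoPoint (n : ℕ) (T : Finset (Site 3)) (a b : Site 3) : ℝ :=
  isingTwoPoint (zdGraph 3) (box 3 n \ T) (criticalBeta 3) 0 .free a b

/-- (backbone) transparency = screening ratio. [cite: AizenmanDuminilCopinAnnals2021, App. A, Lemma A.1] -/
def transparency (n : ℕ) (T : Finset (Site 3)) (a b : Site 3) : ℝ :=
  boxTwoPoint n T a b / boxTwoPoint n ∅ a b

open Classical in
/-- (backbone) the cluster of `o` explored inside `Λ_r`. [cite: AizenmanDuminilCopinAnnals2021, §6.2] -/
def innerCluster (r : ℕ) (o : Site 3) (ω : BondConfig (Site 3)) : Finset (Site 3) :=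
  (box 3 r).filter fun v => v ∈ openClusterIn (withinGraph (zdGraph 3) (↑(box 3 r) : Set (Site 3))) ω o

open Classical in
/-- (backbone) transparency functional of the explored cluster. [cite: AizenmanDuminilCopinAnnals2021, App. A, Lemma A.1] -/
def clusterTransparency (n r : ℕ) (o a b : Site 3) (ω : BondConfig (Site 3)) : ℝ :=
  if a ∈ openCluster ω o ∨ b ∈ openCluster ω o then 0 else transparency n (innerCluster r o ω) a b

/-- (backbone) mean transparency under the box trace law. [cite: AizenmanDuminilCopinAnnals2021, App. A, Lemma A.1] -/
def meanTransparency (n r : ℕ) (o x a b : Site 3) : ℝ :=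
  ∫ ω, clusterTransparency n r o a b ω ∂(sourcedDoubleCurrentLaw 3 n (criticalBeta 3) ({o} ∆ {x}) ∅)

/-- (backbone) far source `p_t = (t,0,t)`. [folklore] -/
def pSrc (t : ℕ) : Site 3 := (t : ℤ) • e₁ + (t : ℤ) • e₃
/-- (backbone) far probe end `q_t = (t,0,-t)`. [folklore] -/
def qPrb (t : ℕ) : Site 3 := (t : ℤ) • e₁ - (t : ℤ) • e₃

/-- (backbone) one-pinch mean transparency `u⁽ⁿ⁾(r,t)`. [folklore] -/
def onePinch (n r t : ℕ) : ℝ := meanTransparency n r 0 (pSrc t) e₂ (qPrb t)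

/-- (backbone, T1). [cite: AizenmanDuminilCopinAnnals2021, eq. (3.7)] -/
def OnePinchTransparencyDecay : Prop :=
  ∃ κ C : ℝ, 0 < κ ∧ ∃ᶠ t : ℕ in atTop, ∀ᶠ n : ℕ in atTop, onePinch n n t ≤ C * (t : ℝ) ^ (-κ)

/-- (backbone) doubling window. [cite: AizenmanDuminilCopinAnnals2021, Def. 5.11 (P1)] -/
def DoublingWindow (θ : ℝ) (k : ℕ) : Prop :=
  ∀ j : ℕ, k ≤ j + 3 → j ≤ k + 3 →
    θ * criticalTwoPoint 3 (((2 : ℤ) ^ j) • e₁) ≤ criticalTwoPoint 3 (((2 : ℤ) ^ (j + 1)) • e₁)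

/-- (backbone, T2). [folklore] -/
def OpaqueScalesIO : Prop :=
  ∃ c θ : ℝ, 0 < c ∧ 0 < θ ∧ ∃ᶠ k : ℕ in atTop, DoublingWindow θ k ∧ ∃ t : ℕ, 2 ^ (k + 2) ≤ t ∧
    ∃ᶠ n : ℕ in atTop, 0 < onePinch n (2 ^ k) t ∧ onePinch n (2 ^ k) t ≤ (1 - c) * onePinch n (2 ^ (k - 1)) t

/-- (backbone, T3). [cite: AizenmanCMP1982, Prop. 5.3] -/
def FarOpacityIO : Prop :=
  ∃ c : ℝ, 0 < c ∧ ∃ y : Fin 4 → Site 3, Function.Injective y ∧ ∀ L₀ : ℕ, ∃ L : ℕ, L₀ ≤ L ∧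
    ∃ᶠ n : ℕ in atTop,
      meanTransparency n n ((L : ℤ) • y 0) ((L : ℤ) • y 1) ((L : ℤ) • y 2) ((L : ℤ) • y 3) ≤ 1 - c

/-! ## The dictionary (definitional) -/

/-- `boxTwoPoint` of the backbone line is `boxTwoPoint` of the screening line. [folklore] -/
theorem boxTwoPoint_eq : boxTwoPoint = GapForcesFarMergingScreening.boxTwoPoint := rfl

/-- TRANSPARENCY = SCREENING (same function). [folklore] -/
theorem transparency_eq : transparency = screening := rfl

/-- The explored clusters agree. [folklore] -/
theorem innerCluster_eq : innerCluster = GapForcesFarMergingScreening.innerCluster := rfl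

/-- `clusterTransparency = screenWeight`. [folklore] -/
theorem clusterTransparency_eq : clusterTransparency = screenWeight := rfl

/-- `meanTransparency = meanScreening`. [folklore] -/
theorem meanTransparency_eq : meanTransparency = meanScreening := rfl

/-- The doubling windows agree. [folklore] -/
theorem doublingWindow_iff (θ : ℝ) (k : ℕ) :
    DoublingWindow θ k ↔ GapForcesFarMergingScreening.DoublingWindow θ k := Iff.rfl

/-- `FarOpacityIO ↔ FarScreeningIO` (same statement). [folklore] -/
theorem farOpacityIO_iff : FarOpacityIO ↔ FarScreeningIO := Iff.rfl

/-- The backbone ladder is the screening mean-screening at the rotated pinch geometry `(t,0,±t)`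
(definitional; the screening ladder `pinchScreen n r m` sits at `(2m,±m,0)`). [folklore] -/
theorem onePinch_eq (n r t : ℕ) : onePinch n r t = meanScreening n r 0 (pSrc t) e₂ (qPrb t) := rfl

/-! ## S4 is a tree theorem; the residual is the screening residual -/

/-- **Backbone stub S4, discharged**: far opacity along dilations of one shape gives far merging — the landed
screening S7 (`stub_farMerging`, ADC21 (3.11) in the box + limits) fed with the landed Lemma-A.1 dictionary S0
(`stub_screeningIdentity`). [cite: AizenmanDuminilCopinAnnals2021, eq. (3.11) and Lemma A.1] -/
theorem stub_farMerging_of_screening : FarOpacityIO → FarMergingShape cc2 (criticalCorr 3 4) :=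
  fun h => stub_farMerging stub_screeningIdentity (farOpacityIO_iff.1 h)

/-- **The backbone line's residual is the screening line's registered residual**: with S4 discharged and S1
the landed one-pinch decay, what the slug still owes (a floor for S2, the un-pinning S3) is implied by — indeed is
the rotated instance of — `Floors ∧ HazardRelocation ∧ Unpin`, from which the crux already follows in the tree
(`gapForcesFarMerging_of_floors_hazardRelocation_unpin`, p121744). Recorded as the composition the planners
should read: no separate backbone obligation remains. [folklore] -/
theorem gapForcesFarMerging_of_screening_residual (hF : Floors) (hH : HazardRelocation) (hU : Unpin) :
    GapForcesFarMerging :=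
  gapForcesFarMerging_of_floors_hazardRelocation_unpin hF hH hU

end Summit.CriticalPhenomena.Ising3DConformalLimit.Cruxes.GapForcesFarMerging.BackboneTransparencyDichotomy

end
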